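import Literature.MathematicalPhysics.QuantumLattice.HubbardCoupledLadderArray
import Literature.MathematicalPhysics.QuantumLattice.HubbardHoppingFamilyLatticeSymmetry
import HarnessLib

/-!
# The bilayer `t–t'–t_⊥–U` Hubbard model by decoration of `ℤ²` (layers = column parity), and THE BILAYER FLOOR
# RULE: `energyDensityTT' t t' U ρ − 2|t_⊥| ≤ e_bilayer(t, t', t_⊥, U; ρ)`

Topic `Literature/MathematicalPhysics/QuantumLattice` (family `hubbard`; `ℤ²`). Sequel of
`SublatticeSelectiveInteractions` / `HubbardCoupledLadderArray` (coset-selective atoms, layer cosets,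
`abs_cellEnergy_const_le`), `SuperlatticeCellEnergyFamilies` (the superlattice calculus) and
`HubbardHoppingFamilyLatticeSymmetry` (sublattice-embedding monotonicity along injective additive maps). Written for
stage S2/S3 of the Hubbard material-oracle programme: most high-`T_c` entries of the validation set are bilayer /
multilayer cuprates (YBCO, Bi-2212, Hg-1223 — the S1 boxes print `t_⊥/t`, e.g. `[0.051, 0.206]` for Hg-1223 OP–IP),
and S3's interlayer step takes `t_⊥` as input, while the certified words are single-layer. Here the bilayer model
is a typed superlattice one-band family on `ℤ²` — layer `0` on the even columns, layer `1` on the odd columns,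
intralayer bonds stretched by `(x,y) ↦ (2x,y)`, the interlayer bond `e₁` from the even columns only — and the
sublattice-embedding monotonicity of the tree turns every certified SQUARE-LATTICE floor into a bilayer floor at
the price `2|t_⊥|` per site.

* §1 the square-lattice `t–t'` model as a two-pair family (`squarePair₁/₂`; `= hubbardTTPrimeFermionInteraction t t' U`
  term by term).
* §2 the stretch `stretchX = latticePairMap (2e₁) e₂` (injective), the stretched pairs `layerPair₁/₂ = stretchX ∘ squarePair`,
  **`decoupledLayers U t t'`** (the two non-interacting layers inside `ℤ²`) and the FLOOR TRANSFER
  `energyDensityTT' t t' U ρ ≤ e_ρ(decoupledLayers U t t')` (`U ≥ 0`, `0 < ρ < 2`).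
* §3 **`bilayerViews U (t, t', t_⊥)`** over `layerPeriods 0`; joint concavity in `(t, t', t_⊥)` over every class;
  at `t_⊥ = 0` every view is `decoupledLayers` (`bilayerViews_zero`); Lipschitz with norm constants `(4, 4, 2)`
  (`R ≥ 2`); and **THE BILAYER FLOOR RULE** `energyDensityTT' t t' U ρ − 2|t_⊥| ≤
  infCellEnergyOn (periodicStatesAt (layerPeriods 0) ρ) (bilayerViews U (t,t',t_⊥)) 2` — a certified single-layer
  floor at filling `ρ` floors the bilayer at the same filling per site, minus `2|t_⊥|` (Hg-1223: `t_⊥/t ≤ 0.21`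
  ⇒ `0.42 t`; kinematic/norm constant, no producer needed).

Everything is PROVED; definitions with bodies (`squarePair₁/₂`, `stretchX`, `layerPair₁/₂`, `decoupledLayers`,
`bilayerViews`), no named fact, no number of record, no `sorry`. HONEST SCOPE: energy words only; one-sided (a
FLOOR rule — caps for the bilayer need trial states or tangent planes of the calculus); the interlayer constant
`2` is the norm row (the true class constant of this direction is smaller); the bilayer's own thermodynamic-limit
identification is not here; nothing certifies a number about a material.

## Mathlib / tree search

REUSED: `hubbardHoppingFamily`, `hoppingPairInteraction(_apply)`, `abs_meanEnergy_hoppingPair_le_four`,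
`vectorHoppingFermionInteraction_eq_smul_one` (`HubbardOneBandHoppingFamilies`); `latticePairMap`, `pairMap_injective_of_det_ne_zero`,
`pairMap_apply`, `hubbardFermionInteraction_apply_eq_onSite_add_sum_vectorHopping`, `diagHoppingFermionInteraction_apply_eq_sum_vectorHopping`,
`mem_thicken_zero_iff` (`LatticeVectorHoppingInteraction`); `tiGroundEnergyDensityAt_hubbardHoppingFamily_le_comp`
(`HubbardHoppingFamilyLatticeSymmetry`); `layerPeriods`, `sublatticeVectorHoppingViews`, `abs_cellEnergy_sublatticeVectorHoppingViews_le`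
(`SublatticeSelectiveInteractions`); `abs_cellEnergy_const_le` (`HubbardCoupledLadderArray`); `viewFamily`, `infCellEnergyOn(_empty)`,
`periodicStatesAt`, `concaveOn_infCellEnergyOn_viewFamily`, `abs_infCellEnergyOn_viewFamily_sub_le`,
`infCellEnergyOn_periodicAt_const_eq_tiGroundEnergyDensityAt` (`SuperlatticeCellEnergyFamilies`);
`tiGroundEnergyDensityAt_hubbardTTPrime_eq_energyDensityTT'_of_one_le` (`HubbardTTPrimeTPPFillingTransport`); `axial2Vec`, `diagVec`.
`lean search 'bilayer|interlayer|decoupledLayers|stretch' --decl` (QuantumLattice): nothing of this kind.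

## References

* R. B. Israel, *Convexity in the Theory of Lattice Gases* (1979), Thm. I.3.4. [cite: Israel1979, Thm. I.3.4]
* O. Bratteli, A. Kishimoto, D. W. Robinson, CMP 64 (1978) 41, Thm. 2. [cite: BratteliKishimotoRobinson1978, Thm. 2 (condition 2)]
* H. Araki, H. Moriya, Rev. Math. Phys. 15 (2003) 93, §4.1. [cite: ArakiMoriya2003, §4.1]
* E. Pavarini et al., PRL 87 (2001) 047003, eq. (1) (one-band parameters incl. interlayer). [cite: PavariniEtAl2001, eq. (1)]
* H. Xu et al. (2024), eq. (1) (the `t–t'` Hubbard Hamiltonian). [cite: XuEtAl2024, eq. (1)]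
-/

noncomputable section

namespace Literature.MathematicalPhysics.QuantumLattice

open Matrix Finset HubbardWave0 Literature.Probability.LatticeModels ThermodynamicLimit
open Literature.Computation.Certificates
open scoped ComplexOrder BigOperators

/-! ### §1. The square-lattice `t–t'` model as a two-pair family -/

section Square

/-- First members of the two standard `t`, `t'` pairs: `e₁`, `e₁ + e₂`. [cite: XuEtAl2024, eq. (1)] -/
def squarePair₁ : Fin 2 → Site 2 := ![unitVec 0, diagVec 0]

/-- Second members: `e₂`, `e₁ − e₂`. [cite: XuEtAl2024, eq. (1)] -/
def squarePair₂ : Fin 2 → Site 2 := ![unitVec 1, diagVec 1]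

/-- **The two-pair family at `(t, t')` IS the tree's `t–t'` interaction** (term by term). [cite: XuEtAl2024, eq. (1)] -/
theorem hubbardHoppingFamily_square_eq (t t' U : ℝ) :
    hubbardHoppingFamily squarePair₁ squarePair₂ U ![t, t'] = hubbardTTPrimeFermionInteraction t t' U := by
  refine FermionInteraction.ext fun X => ?_
  rw [hubbardTTPrimeFermionInteraction_apply, hubbardFermionInteraction_apply_eq_onSite_add_sum_vectorHopping t U X,
    diagHoppingFermionInteraction_apply_eq_sum_vectorHopping, Fin.sum_univ_two, Fin.sum_univ_two,
    vectorHoppingFermionInteraction_eq_smul_one (unitVec 0) t, vectorHoppingFermionInteraction_eq_smul_one (unitVec 1) t,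
    vectorHoppingFermionInteraction_eq_smul_one (diagVec 0) t', vectorHoppingFermionInteraction_eq_smul_one (diagVec 1) t']
  rw [hubbardHoppingFamily, FermionInteraction.linearFamily_apply, Fin.sum_univ_two]
  simp only [hoppingPairInteraction_apply, squarePair₁, squarePair₂, Matrix.cons_val_zero, Matrix.cons_val_one, smul_add]
  abel

/-- The square pairs are nonzero (first members). [cite: XuEtAl2024, eq. (1)] -/
theorem squarePair₁_ne_zero (a : Fin 2) : squarePair₁ a ≠ 0 := by
  fin_cases a
  · exact uvec_ne_zero 0
  · exact diagVec_ne_zero 0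

/-- The square pairs are nonzero (second members). [cite: XuEtAl2024, eq. (1)] -/
theorem squarePair₂_ne_zero (a : Fin 2) : squarePair₂ a ≠ 0 := by
  fin_cases a
  · exact uvec_ne_zero 1
  · exact diagVec_ne_zero 1

/-- The square pairs lie in `[-1,1]²` ⊆ `[-2,2]²` (first members). [cite: FriedliVelenik2017, §3.2] -/
theorem squarePair₁_mem_thicken_two (a : Fin 2) : squarePair₁ a ∈ thicken ({0} : Finset (Site 2)) 2 := by
  fin_cases a
  · exact thicken_mono _ (by norm_num : (1 : ℝ) ≤ 2) (unitVec_mem_thicken_one 0)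
  · exact thicken_mono _ (by norm_num : (1 : ℝ) ≤ 2) (diagVec_mem_thicken_one 0)

/-- (second members). [cite: FriedliVelenik2017, §3.2] -/
theorem squarePair₂_mem_thicken_two (a : Fin 2) : squarePair₂ a ∈ thicken ({0} : Finset (Site 2)) 2 := by
  fin_cases a
  · exact thicken_mono _ (by norm_num : (1 : ℝ) ≤ 2) (unitVec_mem_thicken_one 1)
  · exact thicken_mono _ (by norm_num : (1 : ℝ) ≤ 2) (diagVec_mem_thicken_one 1)

end Square

/-! ### §2. The stretch `(x, y) ↦ (2x, y)` and one layer of the bilayer seen inside `ℤ²` -/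

section Stretch

/-- **The stretch map** `(x, y) ↦ (2x, y)` (`e₁ ↦ 2e₁`, `e₂ ↦ e₂`): it embeds one square-lattice layer as the
even columns of `ℤ²`. [cite: ArakiMoriya2003, §4.1] -/
def stretchX : Site 2 →+ Site 2 := latticePairMap (axial2Vec 0) (unitVec 1)

/-- The stretch is injective (`det = 2`). [cite: ArakiMoriya2003, §4.1] -/
theorem stretchX_injective : Function.Injective stretchX :=
  pairMap_injective_of_det_ne_zero (by simp [axial2Vec, unitVec])

/-- The stretched pair vectors: `2e₁`, `2e₁ + e₂` (first members) — the intralayer `t` and `t'` bonds of a layer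
living on the even columns. [cite: ArakiMoriya2003, §4.1] -/
def layerPair₁ : Fin 2 → Site 2 := ![axial2Vec 0, axial2Vec 0 + unitVec 1]

/-- … and `e₂`, `2e₁ − e₂` (second members). [cite: ArakiMoriya2003, §4.1] -/
def layerPair₂ : Fin 2 → Site 2 := ![unitVec 1, axial2Vec 0 - unitVec 1]

/-- The stretch carries the square pairs onto the layer pairs (first members). [cite: ArakiMoriya2003, §4.1] -/
theorem stretchX_comp_squarePair₁ : stretchX ∘ squarePair₁ = layerPair₁ := by
  funext a
  fin_cases a <;> (ext i; fin_cases i <;> simp [stretchX, pairMap_apply, squarePair₁, layerPair₁, unitVec, diagVec, axial2Vec])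

/-- (second members). [cite: ArakiMoriya2003, §4.1] -/
theorem stretchX_comp_squarePair₂ : stretchX ∘ squarePair₂ = layerPair₂ := by
  funext a
  fin_cases a <;> (ext i; fin_cases i <;>
    simp [stretchX, pairMap_apply, squarePair₂, layerPair₂, unitVec, diagVec_apply_one, axial2Vec])

/-- The layer pairs lie in `[-2,2]²` (first members). [cite: FriedliVelenik2017, §3.2] -/
theorem layerPair₁_mem_thicken_two (a : Fin 2) : layerPair₁ a ∈ thicken ({0} : Finset (Site 2)) 2 := by
  rw [mem_thicken_zero_iff, Nat.floor_ofNat]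
  intro i
  fin_cases a <;> fin_cases i <;> simp [layerPair₁, axial2Vec, unitVec]

/-- (second members). [cite: FriedliVelenik2017, §3.2] -/
theorem layerPair₂_mem_thicken_two (a : Fin 2) : layerPair₂ a ∈ thicken ({0} : Finset (Site 2)) 2 := by
  rw [mem_thicken_zero_iff, Nat.floor_ofNat]
  intro i
  fin_cases a <;> fin_cases i <;> simp [layerPair₂, axial2Vec, unitVec]

/-- **Two decoupled layers inside `ℤ²`**: the `t–t'–U` interaction with the stretched bonds
(`2e₁ | e₂`, `2e₁+e₂ | 2e₁−e₂`) — the even and the odd columns each carry a copy of the square lattice and do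
not talk to each other. [cite: XuEtAl2024, eq. (1)] -/
def decoupledLayers (U t t' : ℝ) : FermionInteraction 2 := hubbardHoppingFamily layerPair₁ layerPair₂ U ![t, t']

/-- **FLOOR TRANSFER TO THE DECOUPLED LAYERS** (`U ≥ 0`, `0 < ρ < 2`): Ruelle's thermodynamic-limit energy
density of the square lattice is a floor for the fixed-filling variational density of the decoupled layers:
`energyDensityTT' t t' U ρ ≤ e_ρ(decoupledLayers U t t')` (sublattice-embedding monotonicity along the stretch).
[cite: BratteliKishimotoRobinson1978, Thm. 2 (condition 2)] -/
theorem energyDensityTT'_le_tiGroundEnergyDensityAt_decoupledLayers (t t' : ℝ) {U : ℝ} (hU : 0 ≤ U) {ρ : ℝ}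
    (hρ0 : 0 < ρ) (hρ2 : ρ < 2) :
    energyDensityTT' t t' U ρ ≤ (decoupledLayers U t t').tiGroundEnergyDensityAt 2 ρ := by
  have h := tiGroundEnergyDensityAt_hubbardHoppingFamily_le_comp stretchX stretchX_injective
    (τ₁ := squarePair₁) (τ₂ := squarePair₂) squarePair₁_ne_zero squarePair₂_ne_zero
    (R := 2) (R' := 2) (by norm_num) (by norm_num) squarePair₁_mem_thicken_two squarePair₂_mem_thicken_two
    (fun a => by rw [← Function.comp_apply (f := stretchX), stretchX_comp_squarePair₁]; exact layerPair₁_mem_thicken_two a)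
    (fun a => by rw [← Function.comp_apply (f := stretchX), stretchX_comp_squarePair₂]; exact layerPair₂_mem_thicken_two a)
    U ![t, t'] ρ
  rw [stretchX_comp_squarePair₁, stretchX_comp_squarePair₂, hubbardHoppingFamily_square_eq,
    tiGroundEnergyDensityAt_hubbardTTPrime_eq_energyDensityTT'_of_one_le t t' hU (by norm_num : (1 : ℝ) ≤ 2) hρ0 hρ2] at h
  exact h

end Stretch

/-! ### §3. The bilayer `t–t'–t_⊥–U` Hubbard model by decoration (layers = column parity) -/

section Bilayer

/-- **The bilayer square-lattice Hubbard model as a superlattice family on `ℤ²`** over `layerPeriods 0`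
(even / odd columns = layer 0 / layer 1): couplings `θ = (t, t', t_⊥)` — intralayer nearest-neighbour bonds
`(2e₁ | e₂)` and diagonal bonds `(2e₁+e₂ | 2e₁−e₂)` (translation invariant, constant views), and the INTERLAYER
bond `e₁` from the EVEN columns only (`(2k, y)–(2k+1, y)`; the `e₁`-bonds from odd columns, which would couple
different rungs, are absent); on-site `U` everywhere. [cite: PavariniEtAl2001, eq. (1)] -/
def bilayerViews (U : ℝ) (θ : Fin 3 → ℝ) : Cell (layerPeriods (0 : Fin 2)) → FermionInteraction 2 :=
  viewFamily (fun _ => hubbardFermionInteraction 2 0 U)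
    (![fun _ => hoppingPairInteraction 2 (layerPair₁ 0) (layerPair₂ 0),
      fun _ => hoppingPairInteraction 2 (layerPair₁ 1) (layerPair₂ 1),
      sublatticeVectorHoppingViews (layerPeriods 0) 0 (unitVec 0) 1]) θ

/-- **Joint concavity of the bilayer's variational cell energy in `(t, t', t_⊥)`** over every class.
[cite: Israel1979, Thm. I.3.4] -/
theorem concaveOn_infCellEnergyOn_bilayer (S : Set (InfVolFermionState 2)) (U R : ℝ) :
    ConcaveOn ℝ Set.univ fun θ : Fin 3 → ℝ => infCellEnergyOn S (bilayerViews U θ) R :=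
  concaveOn_infCellEnergyOn_viewFamily S _ _ R

/-- **At `t_⊥ = 0` every view of the bilayer is the decoupled-layers interaction.** [cite: PavariniEtAl2001, eq. (1)] -/
theorem bilayerViews_zero (U t t' : ℝ) (n : Cell (layerPeriods (0 : Fin 2))) :
    bilayerViews U ![t, t', 0] n = decoupledLayers U t t' := by
  refine FermionInteraction.ext fun X => ?_
  simp only [bilayerViews, decoupledLayers, viewFamily, hubbardHoppingFamily, FermionInteraction.linearFamily_apply,
    Fin.sum_univ_three, Fin.sum_univ_two, Matrix.cons_val_zero, Matrix.cons_val_one, Matrix.cons_val_two, Matrix.head_cons,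
    Matrix.tail_cons, Complex.ofReal_zero, zero_smul, add_zero]

/-- **Lipschitz in the three couplings** (any non-empty class, `R ≥ 2`): constants `(4, 4, 2)` (norm rows).
[cite: Israel1979, Thm. I.3.4] -/
theorem abs_infCellEnergyOn_bilayer_sub_le {S : Set (InfVolFermionState 2)} (hS : S.Nonempty) (U : ℝ) {R : ℝ}
    (hR : 2 ≤ R) (θ θ' : Fin 3 → ℝ) :
    |infCellEnergyOn S (bilayerViews U θ) R - infCellEnergyOn S (bilayerViews U θ') R| ≤
      ∑ a, (![4, 4, 2] : Fin 3 → ℝ) a * |θ a - θ' a| := by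
  have hRR : thicken ({0} : Finset (Site 2)) 2 ⊆ thicken ({0} : Finset (Site 2)) R := thicken_mono _ hR
  refine abs_infCellEnergyOn_viewFamily_sub_le _ _ R hS (fun ω _ a => ?_) θ θ'
  fin_cases a
  · simpa [bilayerViews] using abs_cellEnergy_const_le (q := layerPeriods (0 : Fin 2)) _ R
      (fun σ => σ.abs_meanEnergy_hoppingPair_le_four (d := 2) (v := layerPair₁ 0) (w := layerPair₂ 0)
        (by
          intro h
          have := congrFun h 0
          simp [layerPair₁, axial2Vec] at this)
        (by
          intro h
          have := congrFun h 1
          simp [layerPair₂, unitVec] at this)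
        (hRR (layerPair₁_mem_thicken_two 0)) (hRR (layerPair₂_mem_thicken_two 0))) ω
  · simpa [bilayerViews] using abs_cellEnergy_const_le (q := layerPeriods (0 : Fin 2)) _ R
      (fun σ => σ.abs_meanEnergy_hoppingPair_le_four (d := 2) (v := layerPair₁ 1) (w := layerPair₂ 1)
        (by
          intro h
          have := congrFun h 0
          simp [layerPair₁, axial2Vec, unitVec] at this)
        (by
          intro h
          have := congrFun h 0
          simp [layerPair₂, axial2Vec, unitVec] at this)
        (hRR (layerPair₁_mem_thicken_two 1)) (hRR (layerPair₂_mem_thicken_two 1))) ω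
  · simpa [bilayerViews] using abs_cellEnergy_sublatticeVectorHoppingViews_le (layerPeriods (0 : Fin 2)) 0 (uvec_ne_zero 0) 1
      (hRR (thicken_mono _ (by norm_num : (1 : ℝ) ≤ 2) (unitVec_mem_thicken_one 0))) ω

/-- **THE BILAYER FLOOR RULE.** For `U ≥ 0`, `0 < ρ < 2` and every interlayer hopping `t_⊥`: over the periodic
states of cell filling `ρ`, the bilayer's variational cell energy is at least the CERTIFIED square-lattice
energy density minus `2|t_⊥|`:
`energyDensityTT' t t' U ρ − 2|t_⊥| ≤ inf_{periodic, filling ρ} e_{bilayer(t,t',t_⊥,U)}` — every certified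
single-layer floor of the programme is a floor for bilayer (multilayer-cuprate) boxes, priced by the interlayer
hopping of the S1 box (e.g. `t_⊥/t ≤ 0.21` for Hg-1223 ⇒ `−0.42 t`). [cite: Israel1979, Thm. I.3.4] -/
theorem energyDensityTT'_sub_le_infCellEnergyOn_bilayer (t t' : ℝ) {U : ℝ} (hU : 0 ≤ U) {ρ : ℝ} (hρ0 : 0 < ρ)
    (hρ2 : ρ < 2) (tperp : ℝ) :
    energyDensityTT' t t' U ρ - 2 * |tperp| ≤
      infCellEnergyOn (periodicStatesAt (layerPeriods (0 : Fin 2)) ρ) (bilayerViews U ![t, t', tperp]) 2 := by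
  -- the value at `t_⊥ = 0` is the decoupled-layers density, which is above the square-lattice density
  have h0 : infCellEnergyOn (periodicStatesAt (layerPeriods (0 : Fin 2)) ρ) (bilayerViews U ![t, t', 0]) 2 =
      (decoupledLayers U t t').tiGroundEnergyDensityAt 2 ρ := by
    rw [show bilayerViews U ![t, t', 0] = fun _ => decoupledLayers U t t' from funext fun n => bilayerViews_zero U t t' n]
    exact infCellEnergyOn_periodicAt_const_eq_tiGroundEnergyDensityAt _ _ 2 ρ
  have hfloor := energyDensityTT'_le_tiGroundEnergyDensityAt_decoupledLayers t t' hU hρ0 hρ2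
  rcases (periodicStatesAt (layerPeriods (0 : Fin 2)) ρ).eq_empty_or_nonempty with he | hne
  · -- empty class: both variational values are `0`, and then the square-lattice density is `≤ 0` as well
    rw [he, infCellEnergyOn_empty] at h0 ⊢
    have : energyDensityTT' t t' U ρ ≤ 0 := hfloor.trans (le_of_eq h0.symm)
    linarith [abs_nonneg tperp]
  · have hL := abs_infCellEnergyOn_bilayer_sub_le hne U (R := 2) le_rfl ![t, t', 0] ![t, t', tperp]
    have hs : ∑ a, (![4, 4, 2] : Fin 3 → ℝ) a * |(![t, t', 0] : Fin 3 → ℝ) a - (![t, t', tperp] : Fin 3 → ℝ) a| = 2 * |tperp| := by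
      simp [Fin.sum_univ_three, abs_neg]
    rw [hs, h0] at hL
    have h' := (abs_sub_le_iff.1 hL).1
    linarith

end Bilayer

end Literature.MathematicalPhysics.QuantumLattice

end
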